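import Literature.NumberTheory.Transcendental.NesterenkoEliminationFacts
import Mathlib.RingTheory.Nullstellensatz
import Mathlib.RingTheory.KrullDimension.Field
import Mathlib.RingTheory.MvPolynomial.Ideal
import Mathlib.Analysis.SpecialFunctions.Exp
import HarnessLib

/-!
# Nesterenko's Corollary 4.9 (LNM 1752 Ch. 3 §4, `K = ℚ`, archimedean case) — proofs only

`Literature/NumberTheory/Transcendental/NesterenkoEliminationFactsProofs.lean` — sibling proofs file
of `NesterenkoEliminationFacts.lean` (topic `Literature/NumberTheory/Transcendental`). No new
definitions, no new named facts; proofs only. Main result: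

* `NesterenkoPhilippon2001_ch3_cor_4_9_holds : NesterenkoPhilippon2001_ch3_cor_4_9` — the
  discharge of the named fact vendoring LNM 1752 Ch. 3 Corollary 4.9 (p. 40): for a homogeneous
  prime ideal `𝔭 ⊂ ℚ[x₀, …, x_m]` with `dim 𝔭 = r − 1 ≥ 0`, `ω̄ ∈ ℂ^{m+1} ∖ 0` and a homogeneous
  `A ∈ 𝔭`, `‖A‖_ω̄ ≤ ρ(ω̄) · e^{(2m+1) deg A}`.

## The proof

The book says "The next two Corollaries easily follow from definitions" and refers to
[Nes10, Corollary 1] for the proof; we give the standard argument in full.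

1. *A Lipschitz estimate for forms* (`normAt_le_projDist_mul_exp`). Let `β̄ ∈ V(𝔭)`, so
   `A(β̄) = 0`. Choose `k` with `|β_k| = |β̄|` and put `β̄' = (ω_k/β_k) β̄`; then `A(β̄') = 0`
   (`A` is a form, `aeval_smul_of_isHomogeneous`), `|β̄'| ≤ |ω̄|` and
   `max_i |ω_i − β'_i| = max_i |ω_i β_k − ω_k β_i| / |β̄| ≤ ‖ω̄ − β̄‖ · |ω̄|` (`exists_rep_near`).
   Writing `A(ω̄) = A(ω̄) − A(β̄') = ∑_s a_s (ω̄^s − β̄'^s)` and telescoping each monomial as a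
   product of `deg A = d` linear factors (`norm_prod_sub_prod_le`, `norm_monomial_sub_le`) gives
   `|ω̄^s − β̄'^s| ≤ d ‖ω̄ − β̄‖ |ω̄|^d`, whence
   `|A(ω̄)| ≤ #supp(A) · d · ‖ω̄ − β̄‖ · |A| · |ω̄|^d`. Since every exponent of a monomial of `A`
   is `≤ d`, `#supp(A) ≤ (d+1)^{m+1}` (`card_support_le_of_isHomogeneous`), and
   `d (d+1)^{m+1} ≤ e^{md} e^{(m+1)d} = e^{(2m+1)d}` for `m ≥ 1` (`pow_mul_le_exp`). Dividing by
   `|A| · |ω̄|^{deg A}` gives `‖A‖_ω̄ ≤ ‖ω̄ − β̄‖ e^{(2m+1) deg A}` for every `β̄ ∈ V(𝔭)`.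
2. *`V(𝔭) ≠ ∅`* (`projZeros_nonempty`), so that the infimum `ρ(ω̄)` in (20) is over a non-empty
   set: `𝔭` is its own (only) associated prime, so `IsUnmixedOfRank 𝔭 r` gives
   `dim ℚ[x̲]/𝔭 = r ≥ 1`. If `V(𝔭) ⊂ P^m(ℂ)` were empty, the affine zero locus of `𝔭` in
   `ℂ^{m+1}` would be `⊆ {0}`, so by the (relative, `k = ℚ`, `K = ℂ`) Nullstellensatz of Mathlib
   (`MvPolynomial.IsPrime.vanishingIdeal_zeroLocus`) every `xᵢ` lies in `𝔭`; as `𝔭` is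
   homogeneous and proper it has no non-zero constants, hence `𝔭 = (x₀, …, x_m)` is maximal and
   `dim ℚ[x̲]/𝔭 = 0`, a contradiction.
3. Taking the infimum over `β̄ ∈ V(𝔭)` (`le_csInf`) gives Corollary 4.9.

## References

* [NesterenkoPhilippon2001] Yu. V. Nesterenko, P. Philippon (eds.), *Introduction to Algebraic
  Independence Theory*, LNM 1752, Springer 2001, Ch. 3 (Yu. V. Nesterenko) §4, Corollary 4.9 and
  (20), p. 40 (PDF p. 52).
* [Nes10] Yu. V. Nesterenko, *On the measure of algebraic independence of the values of Ramanujan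
  functions*, Proc. Steklov Inst. Math. 218 (1997) 294–331, §1 Corollary 1 (the proof referred to).
-/

noncomputable section

open MvPolynomial
open scoped NNReal

namespace Literature.NumberTheory.Transcendental

namespace Nesterenko

variable {m : ℕ}

/-! ### Elementary estimates -/

/-- Telescoping: if `|yᵢ|, |zᵢ| ≤ M` and `|yᵢ − zᵢ| ≤ η` on `t`, then
`|∏_t yᵢ − ∏_t zᵢ| ≤ #t · η · M^{#t − 1}`. [folklore] -/
theorem norm_prod_sub_prod_le {ι : Type*} (t : Finset ι) (y z : ι → ℂ) {M η : ℝ} (hM : 0 ≤ M)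
    (hη : 0 ≤ η) (hy : ∀ i ∈ t, ‖y i‖ ≤ M) (hz : ∀ i ∈ t, ‖z i‖ ≤ M)
    (hyz : ∀ i ∈ t, ‖y i - z i‖ ≤ η) :
    ‖∏ i ∈ t, y i - ∏ i ∈ t, z i‖ ≤ t.card * η * M ^ (t.card - 1) := by
  classical
  induction t using Finset.induction_on with
  | empty => simp
  | insert a t ha ih =>
    have hy' : ∀ i ∈ t, ‖y i‖ ≤ M := fun i hi => hy i (Finset.mem_insert_of_mem hi)
    have ih' := ih hy' (fun i hi => hz i (Finset.mem_insert_of_mem hi)) fun i hi =>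
      hyz i (Finset.mem_insert_of_mem hi)
    rw [Finset.prod_insert ha, Finset.prod_insert ha, Finset.card_insert_of_notMem ha,
      Nat.add_sub_cancel]
    have hPy : ‖∏ i ∈ t, y i‖ ≤ M ^ t.card := by
      calc ‖∏ i ∈ t, y i‖ = ∏ i ∈ t, ‖y i‖ := norm_prod _ _
        _ ≤ ∏ _i ∈ t, M := Finset.prod_le_prod (fun i _ => norm_nonneg _) hy'
        _ = M ^ t.card := Finset.prod_const M
    have e : y a * ∏ i ∈ t, y i - z a * ∏ i ∈ t, z i =
        (y a - z a) * ∏ i ∈ t, y i + z a * (∏ i ∈ t, y i - ∏ i ∈ t, z i) := by ring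
    have hc : M * ((t.card : ℝ) * η * M ^ (t.card - 1)) = t.card * η * M ^ t.card := by
      rcases Nat.eq_zero_or_pos t.card with hc | hc
      · rw [hc]; simp
      · obtain ⟨c, hc'⟩ := Nat.exists_eq_succ_of_ne_zero hc.ne'
        rw [hc', Nat.succ_sub_one, pow_succ]; ring
    rw [e]
    calc ‖(y a - z a) * ∏ i ∈ t, y i + z a * (∏ i ∈ t, y i - ∏ i ∈ t, z i)‖
        ≤ ‖y a - z a‖ * ‖∏ i ∈ t, y i‖ + ‖z a‖ * ‖∏ i ∈ t, y i - ∏ i ∈ t, z i‖ := by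
          refine (norm_add_le _ _).trans ?_
          rw [norm_mul, norm_mul]
      _ ≤ η * M ^ t.card + M * ((t.card : ℝ) * η * M ^ (t.card - 1)) :=
          add_le_add (mul_le_mul (hyz a (Finset.mem_insert_self a t)) hPy (norm_nonneg _) hη)
            (mul_le_mul (hz a (Finset.mem_insert_self a t)) ih' (norm_nonneg _) hM)
      _ = ((t.card + 1 : ℕ) : ℝ) * η * M ^ t.card := by rw [hc]; push_cast; ring

/-- For a monomial of degree `d`: `|y^s − z^s| ≤ d · η · M^{d−1}` under the same hypotheses.
[folklore] -/
theorem norm_monomial_sub_le (s : Fin (m + 1) →₀ ℕ) {d : ℕ} (hs : ∑ i, s i = d)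
    (y z : Fin (m + 1) → ℂ) {M η : ℝ} (hM : 0 ≤ M) (hη : 0 ≤ η) (hy : ∀ i, ‖y i‖ ≤ M)
    (hz : ∀ i, ‖z i‖ ≤ M) (hyz : ∀ i, ‖y i - z i‖ ≤ η) :
    ‖∏ i, y i ^ s i - ∏ i, z i ^ s i‖ ≤ d * η * M ^ (d - 1) := by
  classical
  set t : Finset (Σ _ : Fin (m + 1), ℕ) := Finset.univ.sigma fun i => Finset.range (s i) with ht
  have hprod : ∀ x : Fin (m + 1) → ℂ, ∏ i, x i ^ s i = ∏ p ∈ t, x p.1 := by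
    intro x
    rw [Finset.prod_sigma]
    refine Finset.prod_congr rfl fun i _ => ?_
    show x i ^ s i = ∏ _j ∈ Finset.range (s i), x i
    rw [Finset.prod_const, Finset.card_range]
  have hcard : t.card = d := by
    rw [ht, Finset.card_sigma]
    simpa only [Finset.card_range] using hs
  rw [hprod y, hprod z, ← hcard]
  exact norm_prod_sub_prod_le t (fun p => y p.1) (fun p => z p.1) hM hη (fun p _ => hy p.1)
    (fun p _ => hz p.1) (fun p _ => hyz p.1)

/-- The exponents of a monomial of a form of degree `d` sum to `d`. [folklore] -/
theorem sum_eq_of_isHomogeneous {A : Rx m} {d : ℕ} (hA : A.IsHomogeneous d)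
    {s : Fin (m + 1) →₀ ℕ} (hs : s ∈ A.support) : ∑ i, s i = d := by
  have h := hA (mem_support_iff.mp hs)
  rw [Finsupp.weight_apply, Finsupp.sum_fintype _ _ (fun _ => by simp)] at h
  simpa using h

/-- A form of degree `d` satisfies `A(c β̄) = c^d A(β̄)`. [folklore] -/
theorem aeval_smul_of_isHomogeneous (A : Rx m) {d : ℕ} (hA : A.IsHomogeneous d) (c : ℂ)
    (β : Fin (m + 1) → ℂ) : aeval (c • β) A = c ^ d * aeval β A := by
  rw [aeval_def, aeval_def, eval₂_eq', eval₂_eq', Finset.mul_sum]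
  refine Finset.sum_congr rfl fun s hs => ?_
  have hsd : ∑ i, s i = d := sum_eq_of_isHomogeneous hA hs
  simp only [Pi.smul_apply, smul_eq_mul, mul_pow, Finset.prod_mul_distrib,
    Finset.prod_pow_eq_pow_sum, hsd]
  ring

/-- `|A(ȳ) − A(z̄)| ≤ #supp(A) · |A| · d · η · M^{d−1}` for a form `A` of degree `d` with rational
coefficients, when `|yᵢ|, |zᵢ| ≤ M` and `|yᵢ − zᵢ| ≤ η`. [folklore] -/
theorem norm_aeval_sub_aeval_le (A : Rx m) {d : ℕ} (hA : A.IsHomogeneous d)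
    (y z : Fin (m + 1) → ℂ) {M η : ℝ} (hM : 0 ≤ M) (hη : 0 ≤ η) (hy : ∀ i, ‖y i‖ ≤ M)
    (hz : ∀ i, ‖z i‖ ≤ M) (hyz : ∀ i, ‖y i - z i‖ ≤ η) :
    ‖aeval y A - aeval z A‖ ≤ A.support.card * maxNorm A * (d * η * M ^ (d - 1)) := by
  have e : aeval y A - aeval z A =
      ∑ s ∈ A.support, algebraMap ℚ ℂ (coeff s A) * (∏ i, y i ^ s i - ∏ i, z i ^ s i) := by
    rw [aeval_def, aeval_def, eval₂_eq', eval₂_eq', ← Finset.sum_sub_distrib]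
    refine Finset.sum_congr rfl fun s _ => ?_
    ring
  rw [e]
  calc ‖∑ s ∈ A.support, algebraMap ℚ ℂ (coeff s A) * (∏ i, y i ^ s i - ∏ i, z i ^ s i)‖
      ≤ ∑ s ∈ A.support, ‖algebraMap ℚ ℂ (coeff s A) * (∏ i, y i ^ s i - ∏ i, z i ^ s i)‖ :=
        norm_sum_le _ _
    _ ≤ ∑ _s ∈ A.support, maxNorm A * (d * η * M ^ (d - 1)) := by
        refine Finset.sum_le_sum fun s hs => ?_
        rw [norm_mul]
        refine mul_le_mul ?_ ?_ (norm_nonneg _) (maxNorm_nonneg _)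
        · have hn : ‖algebraMap ℚ ℂ (coeff s A)‖ = ‖coeff s A‖ := by
            rw [eq_ratCast, Complex.norm_ratCast, ← Real.norm_eq_abs, Rat.norm_cast_real]
          rw [hn]
          exact norm_coeff_le_maxNorm A s
        · exact norm_monomial_sub_le s (sum_eq_of_isHomogeneous hA hs) y z hM hη hy hz hyz
    _ = A.support.card * maxNorm A * (d * η * M ^ (d - 1)) := by
        rw [Finset.sum_const, nsmul_eq_mul]
        ring

/-- A form of degree `d` in `m + 1` variables has at most `(d+1)^{m+1}` monomials. [folklore] -/
theorem card_support_le_of_isHomogeneous (A : Rx m) {d : ℕ} (hA : A.IsHomogeneous d) :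
    A.support.card ≤ (d + 1) ^ (m + 1) := by
  classical
  have hsub : ∀ s ∈ A.support, ∀ i, s i ≤ d := by
    intro s hs i
    rw [← sum_eq_of_isHomogeneous hA hs]
    exact Finset.single_le_sum (fun j _ => Nat.zero_le (s j)) (Finset.mem_univ i)
  calc A.support.card
      ≤ (Fintype.piFinset fun _ : Fin (m + 1) => Finset.range (d + 1)).card := by
        refine Finset.card_le_card_of_injOn (fun s => ⇑s) (fun s hs => ?_) ?_
        · rw [Finset.mem_coe, Fintype.mem_piFinset]
          exact fun i => Finset.mem_range.mpr (Nat.lt_succ_of_le (hsub s hs i))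
        · intro s₁ _ s₂ _ h
          exact DFunLike.coe_injective h
    _ = (d + 1) ^ (m + 1) := by
        rw [Fintype.card_piFinset_const, Finset.card_range]

/-- The numerical inequality `(d+1)^{m+1} · d ≤ e^{(2m+1)d}` (`m ≥ 1`). [folklore] -/
theorem pow_mul_le_exp {m d : ℕ} (hm : 1 ≤ m) :
    ((d : ℝ) + 1) ^ (m + 1) * d ≤ Real.exp ((2 * m + 1 : ℝ) * d) := by
  have h1 : (d : ℝ) + 1 ≤ Real.exp d := Real.add_one_le_exp (d : ℝ)
  have h2 : ((d : ℝ) + 1) ^ (m + 1) ≤ Real.exp d ^ (m + 1) := pow_le_pow_left₀ (by positivity) h1 _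
  have h3 : (d : ℝ) ≤ Real.exp (m * d) := by
    calc (d : ℝ) ≤ d + 1 := by linarith
      _ ≤ Real.exp d := h1
      _ ≤ Real.exp (m * d) :=
          Real.exp_le_exp.mpr (le_mul_of_one_le_left (Nat.cast_nonneg _) (by exact_mod_cast hm))
  calc ((d : ℝ) + 1) ^ (m + 1) * d ≤ Real.exp d ^ (m + 1) * Real.exp (m * d) :=
        mul_le_mul h2 h3 (Nat.cast_nonneg _) (by positivity)
    _ = Real.exp ((2 * m + 1 : ℝ) * d) := by
        rw [← Real.exp_nat_mul, ← Real.exp_add]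
        congr 1
        push_cast
        ring

/-- Each `|ωᵢβ_k − ω_kβᵢ|` is bounded by the maximum over the pairs `i < j` defining the projective
distance. [folklore] -/
theorem norm_cross_le_sup (ω β : Fin (m + 1) → ℂ) (i k : Fin (m + 1)) :
    ‖ω i * β k - ω k * β i‖ ≤
      ((Finset.univ.sup fun p : SkewIdx m => ‖ω p.1.1 * β p.1.2 - ω p.1.2 * β p.1.1‖₊ : ℝ≥0) :
        ℝ) := by
  set f : SkewIdx m → ℝ≥0 := fun p => ‖ω p.1.1 * β p.1.2 - ω p.1.2 * β p.1.1‖₊ with hf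
  rcases lt_trichotomy i k with h | h | h
  · have h1 : f ⟨(i, k), h⟩ ≤ Finset.univ.sup f := Finset.le_sup (Finset.mem_univ _)
    rw [← coe_nnnorm]
    exact NNReal.coe_le_coe.mpr h1
  · subst h
    rw [sub_self, norm_zero]
    exact NNReal.coe_nonneg _
  · have h1 : f ⟨(k, i), h⟩ ≤ Finset.univ.sup f := Finset.le_sup (Finset.mem_univ _)
    rw [norm_sub_rev, ← coe_nnnorm]
    exact NNReal.coe_le_coe.mpr h1

/-- Projective rescaling: for `ω̄, β̄ ≠ 0` there is a multiple `β̄' = c β̄` of `β̄` with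
`|β̄'| ≤ |ω̄|` and `max_i |ω_i − β'_i| ≤ ‖ω̄ − β̄‖ · |ω̄|` (take `c = ω_k / β_k` with
`|β_k| = |β̄|`). [folklore] -/
theorem exists_rep_near {ω β : Fin (m + 1) → ℂ} (hω : ω ≠ 0) (hβ : β ≠ 0) :
    ∃ c : ℂ, (∀ i, ‖(c • β) i‖ ≤ ‖ω‖) ∧ ∀ i, ‖ω i - (c • β) i‖ ≤ projDist ω β * ‖ω‖ := by
  obtain ⟨k, -, hk⟩ :=
    Finset.exists_max_image Finset.univ (fun i => ‖β i‖) Finset.univ_nonempty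
  have hβk : ‖β k‖ = ‖β‖ :=
    le_antisymm (norm_le_pi_norm β k)
      ((pi_norm_le_iff_of_nonneg (norm_nonneg _)).mpr fun i => hk i (Finset.mem_univ i))
  have hβpos : 0 < ‖β‖ := norm_pos_iff.mpr hβ
  have hωpos : 0 < ‖ω‖ := norm_pos_iff.mpr hω
  have hβk0 : β k ≠ 0 := by rw [← norm_pos_iff, hβk]; exact hβpos
  have hsup : ∀ i, ‖ω i * β k - ω k * β i‖ ≤ projDist ω β * (‖ω‖ * ‖β‖) := by
    intro i
    rw [projDist, div_mul_cancel₀ _ (mul_ne_zero hωpos.ne' hβpos.ne')]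
    exact norm_cross_le_sup ω β i k
  refine ⟨ω k / β k, fun i => ?_, fun i => ?_⟩
  · rw [Pi.smul_apply, smul_eq_mul, norm_mul, norm_div]
    calc ‖ω k‖ / ‖β k‖ * ‖β i‖ ≤ ‖ω k‖ / ‖β k‖ * ‖β k‖ := by
          gcongr
          exact hk i (Finset.mem_univ i)
      _ = ‖ω k‖ := div_mul_cancel₀ _ (by rw [hβk]; exact hβpos.ne')
      _ ≤ ‖ω‖ := norm_le_pi_norm ω k
  · have e : ω i - ((ω k / β k) • β) i = (ω i * β k - ω k * β i) / β k := by
      rw [Pi.smul_apply, smul_eq_mul, div_mul_eq_mul_div, eq_div_iff hβk0, sub_mul,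
        div_mul_cancel₀ _ hβk0]
    rw [e, norm_div, hβk]
    calc ‖ω i * β k - ω k * β i‖ / ‖β‖ ≤ projDist ω β * (‖ω‖ * ‖β‖) / ‖β‖ := by
          gcongr
          exact hsup i
      _ = projDist ω β * ‖ω‖ := by rw [← mul_assoc, mul_div_cancel_right₀ _ hβpos.ne']

/-- **The estimate behind Corollary 4.9**: if the form `A` of degree `d` vanishes at `β̄ ≠ 0`, then
`‖A‖_ω̄ ≤ ‖ω̄ − β̄‖ · e^{(2m+1)d}` (`m ≥ 1`).
[cite: NesterenkoPhilippon2001, Ch. 3 Cor. 4.9 (p. 40)] -/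
theorem normAt_le_projDist_mul_exp (hm : 1 ≤ m) (A : Rx m) {d : ℕ} (hA : A.IsHomogeneous d)
    {ω β : Fin (m + 1) → ℂ} (hω : ω ≠ 0) (hβ : β ≠ 0) (hAβ : aeval β A = 0) :
    normAt ω A ≤ projDist ω β * Real.exp ((2 * m + 1 : ℝ) * d) := by
  have hRHS : 0 ≤ projDist ω β * Real.exp ((2 * m + 1 : ℝ) * d) :=
    mul_nonneg (projDist_nonneg _ _) (Real.exp_pos _).le
  by_cases hA0 : A = 0
  · subst hA0
    simpa [normAt] using hRHS
  obtain ⟨c, hc1, hc2⟩ := exists_rep_near hω hβ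
  have hAβ' : aeval (c • β) A = 0 := by
    rw [aeval_smul_of_isHomogeneous A hA, hAβ, mul_zero]
  have hωpos : 0 < ‖ω‖ := norm_pos_iff.mpr hω
  have hmaxpos : 0 < maxNorm A := by
    obtain ⟨s, hs⟩ := exists_coeff_ne_zero hA0
    exact (norm_pos_iff.mpr hs).trans_le (norm_coeff_le_maxNorm A s)
  have hdeg : A.totalDegree = d := hA.totalDegree hA0
  have h1 := norm_aeval_sub_aeval_le A hA ω (c • β) hωpos.le
    (mul_nonneg (projDist_nonneg ω β) hωpos.le) (fun i => norm_le_pi_norm ω i) hc1 hc2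
  rw [hAβ', sub_zero] at h1
  have h2 : (d : ℝ) * (projDist ω β * ‖ω‖) * ‖ω‖ ^ (d - 1) = d * projDist ω β * ‖ω‖ ^ d := by
    rcases Nat.eq_zero_or_pos d with hd | hd
    · subst hd; simp
    · obtain ⟨d', rfl⟩ := Nat.exists_eq_succ_of_ne_zero hd.ne'
      rw [Nat.succ_sub_one, pow_succ]; ring
  have h3 : (A.support.card : ℝ) * d ≤ Real.exp ((2 * m + 1 : ℝ) * d) := by
    have hcard := card_support_le_of_isHomogeneous A hA
    calc (A.support.card : ℝ) * d ≤ ((d : ℝ) + 1) ^ (m + 1) * d := by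
          gcongr
          exact_mod_cast hcard
      _ ≤ _ := pow_mul_le_exp hm
  have h4 : 0 ≤ projDist ω β * (maxNorm A * ‖ω‖ ^ d) :=
    mul_nonneg (projDist_nonneg _ _) (mul_nonneg hmaxpos.le (pow_nonneg hωpos.le _))
  have hmain : ‖aeval ω A‖ ≤
      projDist ω β * Real.exp ((2 * m + 1 : ℝ) * d) * (maxNorm A * ‖ω‖ ^ d) := by
    calc ‖aeval ω A‖ ≤ A.support.card * maxNorm A * (d * (projDist ω β * ‖ω‖) * ‖ω‖ ^ (d - 1)) :=
          h1
      _ = A.support.card * d * (projDist ω β * (maxNorm A * ‖ω‖ ^ d)) := by rw [h2]; ring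
      _ ≤ Real.exp ((2 * m + 1 : ℝ) * d) * (projDist ω β * (maxNorm A * ‖ω‖ ^ d)) :=
          mul_le_mul_of_nonneg_right h3 h4
      _ = _ := by ring
  rw [normAt, hdeg, div_le_iff₀ (mul_pos hmaxpos (pow_pos hωpos d))]
  exact hmain

/-! ### Non-emptiness of `V(𝔭)` -/

/-- For a prime ideal `𝔭 ⊂ ℚ[x̲]` without non-zero constant terms (e.g. homogeneous and proper)
and with `dim ℚ[x̲]/𝔭 = r ≥ 1` (i.e. `dim 𝔭 ≥ 0` projectively), the projective variety
`V(𝔭) ⊂ P^m(ℂ)` is non-empty (projective Nullstellensatz). [folklore] -/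
theorem projZeros_nonempty {r : ℕ} (𝔭 : Ideal (Rx m)) (hr : 1 ≤ r) (h𝔭 : 𝔭.IsPrime)
    (hconst : ∀ P ∈ 𝔭, constantCoeff P = 0) (hunm : IsUnmixedOfRank 𝔭 r) :
    (projZeros 𝔭).Nonempty := by
  classical
  by_contra hempty
  rw [Set.not_nonempty_iff_eq_empty] at hempty
  -- `dim ℚ[x̲]/𝔭 = r`: `𝔭` is an associated prime of itself.
  have hdim : ringKrullDim (Rx m ⧸ 𝔭) = r := by
    refine hunm.2 𝔭 ⟨h𝔭, 1, ?_⟩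
    have hcol : Submodule.colon 𝔭 {(1 : Rx m)} = 𝔭 := by
      ext a; rw [Submodule.mem_colon_singleton, smul_eq_mul, mul_one]
    rw [hcol, h𝔭.radical]
  -- every variable lies in `𝔭` (Nullstellensatz over `ℂ` for the ideal `𝔭` over `ℚ`)
  have hX : ∀ i, (X i : Rx m) ∈ 𝔭 := by
    intro i
    have h1 : (X i : Rx m) ∈
        MvPolynomial.vanishingIdeal ℚ (MvPolynomial.zeroLocus ℂ 𝔭) := by
      rw [MvPolynomial.mem_vanishingIdeal_iff]
      intro x hx
      have hx0 : x = 0 := by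
        by_contra hx0
        simpa [hempty] using (show x ∈ projZeros 𝔭 from ⟨hx0, fun P hP => hx P hP⟩)
      rw [hx0, aeval_X, Pi.zero_apply]
    haveI := h𝔭
    rwa [MvPolynomial.IsPrime.vanishingIdeal_zeroLocus (K := ℂ) 𝔭] at h1
  -- hence `𝔭` is the irrelevant ideal `𝔪 = (x₀, …, x_m)`, which is maximal
  set 𝔪 : Ideal (Rx m) := MvPolynomial.vanishingIdeal ℚ {(0 : Fin (m + 1) → ℚ)} with h𝔪
  have h𝔭𝔪 : 𝔭 ≤ 𝔪 := by
    intro P hP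
    rw [h𝔪, MvPolynomial.mem_vanishingIdeal_singleton_iff, aeval_zero, hconst P hP, map_zero]
  have h𝔪𝔭 : 𝔪 ≤ 𝔭 := by
    intro P hP
    rw [h𝔪, MvPolynomial.mem_vanishingIdeal_singleton_iff, aeval_zero, Algebra.algebraMap_self,
      RingHom.id_apply] at hP
    have hspan : P ∈ Ideal.span (X '' (Set.univ : Set (Fin (m + 1))) : Set (Rx m)) := by
      rw [MvPolynomial.mem_ideal_span_X_image]
      intro s hs
      have hs0 : s ≠ 0 := by
        rintro rfl
        rw [mem_support_iff, ← constantCoeff_eq] at hs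
        exact hs hP
      obtain ⟨i, hi⟩ := Finsupp.ne_iff.mp hs0
      exact ⟨i, Set.mem_univ _, hi⟩
    refine (Ideal.span_le.mpr ?_) hspan
    rintro _ ⟨i, -, rfl⟩
    exact hX i
  have heq : 𝔭 = 𝔪 := le_antisymm h𝔭𝔪 h𝔪𝔭
  have hmax : 𝔪.IsMaximal := inferInstance
  have hfield : IsField (Rx m ⧸ 𝔭) := by
    rw [heq]
    exact (Ideal.Quotient.maximal_ideal_iff_isField_quotient 𝔪).mp hmax
  have h0 : ringKrullDim (Rx m ⧸ 𝔭) = 0 := ringKrullDim_eq_zero_of_isField hfield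
  rw [hdim] at h0
  have hr0 : r = 0 := by exact_mod_cast h0
  omega

/-! ### Corollary 4.9 -/

/-- **LNM 1752 Ch. 3 Corollary 4.9** (archimedean case, `K = ℚ`), discharged: for a homogeneous
prime `𝔭 ⊂ ℚ[x₀, …, x_m]` with `dim 𝔭 = r − 1 ≥ 0`, `ω̄ ∈ ℂ^{m+1} ∖ 0` and a homogeneous `A ∈ 𝔭`,
`‖A‖_ω̄ ≤ ρ(ω̄) · e^{(2m+1) deg A}`.
[cite: NesterenkoPhilippon2001, Ch. 3 Cor. 4.9 (p. 40)] -/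
theorem NesterenkoPhilippon2001_ch3_cor_4_9_holds : NesterenkoPhilippon2001_ch3_cor_4_9 := by
  intro m r 𝔭 hr hrm h𝔭 hhom hunm A d hA hAd ω hω
  have hm : 1 ≤ m := hr.trans hrm
  -- `𝔭` has no non-zero constants, being homogeneous and proper
  have hconst : ∀ P ∈ 𝔭, constantCoeff P = 0 := by
    intro P hP
    by_contra hc
    have h0 : C (constantCoeff P) ∈ 𝔭 := by
      rw [constantCoeff_eq, ← homogeneousComponent_zero]
      exact homogeneousComponent_mem_of_mem hhom hP 0
    exact h𝔭.ne_top (Ideal.eq_top_of_isUnit_mem 𝔭 h0 ((isUnit_iff_ne_zero.mpr hc).map C))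
  have hne : (projDist ω '' projZeros 𝔭).Nonempty :=
    (projZeros_nonempty 𝔭 hr h𝔭 hconst hunm).image _
  have hexp : 0 < Real.exp ((2 * m + 1 : ℝ) * d) := Real.exp_pos _
  rw [← div_le_iff₀ hexp]
  refine le_csInf hne ?_
  rintro _ ⟨β, hβ, rfl⟩
  rw [div_le_iff₀ hexp]
  exact normAt_le_projDist_mul_exp hm A hAd hω hβ.1 (hβ.2 A hA)

end Nesterenko

end Literature.NumberTheory.Transcendental

end
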